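import Literature.RingTheory.KrullDimension.BaseChangeDimension
import Literature.RingTheory.KrullDimension.AffineCatenary
import Literature.RingTheory.HilbertSamuel.HilbertSamuelCompletionPsi
import Summits.ResolutionOfSingularities.ResolutionOfSingularities.Theorems.HilbertSamuelEliminationSigmaMaxModificationsCorridor3WLadderAlgIsolatedHypersurface
import HarnessLib

/-!
# [OURS · L1 W4.2] K2-sep ROUTE A, brick (β2): **`ψ` IS INVARIANT UNDER GROUND-FIELD EXTENSION** — for `A` of finite type over a field `k`,
# ANY algebraic extension `K/k`, and a prime `𝔓 ⊂ A ⊗ₖ K` over `𝔭 ⊂ A`: `ψ[(A ⊗ₖ K)_𝔓] = ψ[A_𝔭]`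
# (`ψ` = `minimalPrimesCodim`, CJS Def. 2.28 (2): the least coheight of a minimal prime). Dimension theory only (no separability):
# the irreducible components of `X ×_k K` through `x′` lie over those of `X` through `x` with the same dimension (Görtz–Wedhorn 5.38,
# tree `ringKrullDim_quotient_eq_of_isPushout_of_mem_minimalPrimes`), affine domains are catenary (tree `ringKrullDim_quotient_add_height`),
# and `dim {x′}⁻ = dim {x}⁻`.
# (crux `SigmaMaxModifications` stmt-ResolutionOfSingularities-18506 / conjunct stmt-…-19249; line `w_ladder_rows` v8.5, registered stub
# `stub_isoSepRecurrent`; res-L1-w42-plan-1 WORD 2026-08-27T16:25:47Z; design `L/res-L1-w42-stub-2/k2sep/K2SEP-DESIGN.md` §6 (β2))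

Prover res-L1-w42-stub-2 (gen 5). Helper file `--supports stmt-ResolutionOfSingularities-19249 --as helper`; no definitions, no named fact. OURS
(cell res-hironaka, slot W4.2); NOT statements of [Hironaka2017] nor of [CossartJannsenSaito2020]. AI-written; AI review is weaker than expert
review. With (β1) `hilbertFun_localization_tensorProduct_eq` (separable `K/k`) this gives `H_{X_K}(x′) = H_X(x)` at EVERY point of a separable
ground-field base change, hence (β3) `X_{K,max} = pr⁻¹ X_max` and the transfer of isolation.

* `mem_minimalPrimes_map_under_of_isIntegral` — along an INTEGRAL algebra every prime `P` is minimal over `(P ∩ R)·B` (incomparability).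
* `height_map_quotient_eq_of_mem_minimalPrimes` — for a minimal prime `Q ⊆ 𝔓` of `A ⊗ₖ K` over the minimal prime `q ⊆ 𝔭` of `A`:
  `ht(𝔓/Q) = ht(𝔭/q)` (catenarity of the affine domains `(A ⊗ₖ K)/Q`, `A/q` + GW 5.38 twice).
* `ringKrullDim_localization_quotient_map_eq_height` — `dim (B_𝔓 / Q B_𝔓) = ht(𝔓/Q)`.
* minimal primes of a localization `B_𝔓` ↔ minimal primes of `B` inside `𝔓` (`under_mem_minimalPrimes_of_isLocalization`,
  `map_mem_minimalPrimes_localization`).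
* **`minimalPrimesCodim_localization_tensorProduct_eq`** — `ψ[(A ⊗ₖ K)_𝔓] = ψ[A_𝔭]`.

[OURS · L1 W4.2; AI-written] [cite: CossartJannsenSaito2020, Def. 2.28 (2)] [cite: GortzWedhorn2020, Prop. 5.38] [cite: Matsumura1987, Thm 5.6, Thm 9.4]
-/

set_option linter.dupNamespace false

noncomputable section

open scoped TensorProduct
open IsLocalRing Literature.RingTheory.HilbertSamuel Literature.RingTheory.KrullDimension
open Summit.ResolutionOfSingularities.ResolutionOfSingularities.Cruxes.SigmaMaxModifications.IdeasL1C4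

namespace Summit.ResolutionOfSingularities.ResolutionOfSingularities.Theorems.SigmaMaxModificationsCorridor3.IsoTailsHS

universe u

/-! ## §1. Generic lemmas: minimal primes along integral maps and localizations -/

section Generic

variable {R B : Type u} [CommRing R] [CommRing B] [Algebra R B]

/-- Along an INTEGRAL algebra `R → B`, every prime `P` of `B` is a minimal prime over `(P ∩ R)·B` (incomparability, Mathlib
`Ideal.IsIntegral.comap_lt_comap`). [cite: Matsumura1987, Thm 9.3] -/
theorem mem_minimalPrimes_map_under_of_isIntegral [Algebra.IsIntegral R B] (P : Ideal B) [P.IsPrime] :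
    P ∈ ((P.under R).map (algebraMap R B)).minimalPrimes := by
  refine ⟨⟨inferInstance, Ideal.map_le_iff_le_comap.mpr le_rfl⟩, fun Q ⟨hQ, hQle⟩ hQP => ?_⟩
  haveI := hQ
  by_contra hPQ
  have hlt : Q < P := lt_of_le_of_ne hQP fun h => hPQ (h ▸ le_rfl)
  have h1 : Q.comap (algebraMap R B) < P.comap (algebraMap R B) := Ideal.IsIntegral.comap_lt_comap hlt
  have h2 : P.comap (algebraMap R B) ≤ Q.comap (algebraMap R B) := Ideal.map_le_iff_le_comap.mp hQle
  exact absurd (lt_of_lt_of_le h1 h2) (lt_irrefl _)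

/-- A minimal prime of the whole ring is a minimal prime over every ideal it contains. [folklore] -/
theorem mem_minimalPrimes_of_mem_minimalPrimes_of_le {I Q : Ideal B} (hQ : Q ∈ minimalPrimes B) (hIQ : I ≤ Q) :
    Q ∈ I.minimalPrimes :=
  ⟨⟨hQ.1.1, hIQ⟩, fun _ ⟨hP, _⟩ hPQ => hQ.2 ⟨hP, bot_le⟩ hPQ⟩

/-- The contraction of a minimal prime of a localization `M⁻¹B` is a minimal prime of `B`. [folklore] -/
theorem under_mem_minimalPrimes_of_isLocalization (M : Submonoid B) (S : Type u) [CommRing S] [Algebra B S] [IsLocalization M S]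
    {𝔔 : Ideal S} (h𝔔 : 𝔔 ∈ minimalPrimes S) : 𝔔.under B ∈ minimalPrimes B := by
  haveI := h𝔔.1.1
  refine ⟨⟨Ideal.IsPrime.under B 𝔔, bot_le⟩, fun Q' ⟨hQ', _⟩ hle => ?_⟩
  haveI := hQ'
  have hdisj𝔔 : Disjoint (M : Set B) (𝔔.under B) := by
    rw [Set.disjoint_left]
    intro m hm hm𝔔
    exact h𝔔.1.1.ne_top (Ideal.eq_top_of_isUnit_mem _ (Ideal.mem_comap.mp hm𝔔) (IsLocalization.map_units S ⟨m, hm⟩))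
  have hdisj : Disjoint (M : Set B) Q' := Set.disjoint_of_subset_right hle hdisj𝔔
  haveI : (Q'.map (algebraMap B S)).IsPrime := IsLocalization.isPrime_of_isPrime_disjoint M S Q' hQ' hdisj
  have hle' : Q'.map (algebraMap B S) ≤ 𝔔 := by
    rw [← IsLocalization.map_under M S 𝔔]; exact Ideal.map_mono hle
  have heq : Q'.map (algebraMap B S) = 𝔔 := le_antisymm hle' (h𝔔.2 ⟨inferInstance, bot_le⟩ hle')
  rw [← heq, IsLocalization.under_map_of_isPrime_disjoint M S hQ' hdisj]

/-- The extension of a minimal prime of `B` disjoint from `M` is a minimal prime of `M⁻¹B`. [folklore] -/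
theorem map_mem_minimalPrimes_localization (M : Submonoid B) (S : Type u) [CommRing S] [Algebra B S] [IsLocalization M S]
    {Q : Ideal B} (hQ : Q ∈ minimalPrimes B) (hdisj : Disjoint (M : Set B) Q) :
    Q.map (algebraMap B S) ∈ minimalPrimes S := by
  haveI := hQ.1.1
  haveI : (Q.map (algebraMap B S)).IsPrime := IsLocalization.isPrime_of_isPrime_disjoint M S Q hQ.1.1 hdisj
  refine ⟨⟨inferInstance, bot_le⟩, fun 𝔔' ⟨h𝔔', _⟩ hle => ?_⟩
  haveI := h𝔔'
  have h1 : 𝔔'.under B ≤ Q := by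
    have := Ideal.comap_mono (f := algebraMap B S) hle
    rwa [← Ideal.under_def, ← Ideal.under_def, IsLocalization.under_map_of_isPrime_disjoint M S hQ.1.1 hdisj] at this
  have h2 : Q ≤ 𝔔'.under B := hQ.2 ⟨Ideal.IsPrime.under B 𝔔', bot_le⟩ h1
  calc Q.map (algebraMap B S) ≤ (𝔔'.under B).map (algebraMap B S) := Ideal.map_mono h2
    _ = 𝔔' := IsLocalization.map_under M S 𝔔'

end Generic

/-! ## §2. `dim (B_𝔓 / Q B_𝔓) = ht(𝔓/Q)` -/

/-- **`dim (B_𝔓 ⧸ Q·B_𝔓) = ht_{B/Q}(𝔓/Q)`** for ideals `Q ⊆ 𝔓`, `𝔓` prime: `B_𝔓/QB_𝔓 ≅ (B/Q)_{𝔓/Q}` (tree `exists_ringEquiv_localization_quotient`)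
and the dimension of a localization at a prime is its height. [folklore] -/
theorem ringKrullDim_localization_quotient_map_eq_height {B : Type u} [CommRing B] (Q 𝔓 : Ideal B) [𝔓.IsPrime] (hQ𝔓 : Q ≤ 𝔓) :
    ringKrullDim (Localization.AtPrime 𝔓 ⧸ Q.map (algebraMap B (Localization.AtPrime 𝔓))) =
      (𝔓.map (Ideal.Quotient.mk Q)).height := by
  have hker : RingHom.ker (Ideal.Quotient.mk Q) ≤ 𝔓 := by rw [Ideal.mk_ker]; exact hQ𝔓
  haveI : (𝔓.map (Ideal.Quotient.mk Q)).IsPrime := Ideal.map_isPrime_of_surjective Ideal.Quotient.mk_surjective hker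
  have hcomap : 𝔓 = (𝔓.map (Ideal.Quotient.mk Q)).comap (Ideal.Quotient.mk Q) := by
    rw [Ideal.comap_map_of_surjective _ Ideal.Quotient.mk_surjective, eq_comm, sup_eq_left]
    intro x hx
    exact hker hx
  obtain ⟨e⟩ := exists_ringEquiv_localization_quotient Q (𝔓.map (Ideal.Quotient.mk Q)) 𝔓 hcomap
  rw [ringKrullDim_eq_of_ringEquiv e]
  exact IsLocalization.AtPrime.ringKrullDim_eq_height (𝔓.map (Ideal.Quotient.mk Q)) (Localization.AtPrime (𝔓.map (Ideal.Quotient.mk Q)))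

/-! ## §3. Base change of a finite-type algebra along an algebraic field extension -/

section BaseChange

variable {k K A : Type u} [Field k] [Field K] [Algebra k K] [CommRing A] [Algebra k A] [Algebra.FiniteType k A]

/-- `A ⊗ₖ K` is of finite type over `K` (for the right algebra structure `Algebra.TensorProduct.rightAlgebra`, supplied as a term —
no instance is registered). [folklore] -/
theorem finiteType_tensorProduct_right :
    letI : Algebra K (A ⊗[k] K) := Algebra.TensorProduct.rightAlgebra
    Algebra.FiniteType K (A ⊗[k] K) := by
  letI : Algebra K (A ⊗[k] K) := Algebra.TensorProduct.rightAlgebra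
  let e : K ⊗[k] A ≃ₐ[K] A ⊗[k] K :=
    AlgEquiv.ofRingEquiv (f := (Algebra.TensorProduct.comm k K A).toRingEquiv) fun c => by
      show Algebra.TensorProduct.comm k K A (algebraMap K (K ⊗[k] A) c) = algebraMap K (A ⊗[k] K) c
      rw [Algebra.TensorProduct.algebraMap_apply, Algebra.algebraMap_self, RingHom.id_apply]
      simp only [Algebra.TensorProduct.comm_tmul]
      rfl
  exact Algebra.FiniteType.equiv inferInstance e

/-- Dimensions of affine domains are natural numbers. [folklore] -/
theorem exists_nat_ringKrullDim_quotient (F : Type u) [Field F] {D : Type u} [CommRing D] [Algebra F D] [Algebra.FiniteType F D]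
    (P : Ideal D) [P.IsPrime] : ∃ n : ℕ, ringKrullDim (D ⧸ P) = n := by
  obtain ⟨n, hn, -⟩ := exists_ringKrullDim_eq_and_trdeg_eq F (D ⧸ P)
  exact ⟨n, hn⟩

/-- **`ht(𝔓/Q) = ht(𝔭/q)`**: for `A` of finite type over `k`, `K/k` algebraic, `Q ⊆ 𝔓` primes of `A ⊗ₖ K` with `Q` MINIMAL, and
`q = Q ∩ A ⊆ 𝔭 = 𝔓 ∩ A`: the height of `𝔓/Q` in the affine domain `(A ⊗ₖ K)/Q` equals the height of `𝔭/q` in `A/q`. Both domains are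
catenary (`dim D/P + ht P = dim D`), `dim (A ⊗ₖ K)/Q = dim A/q` and `dim (A ⊗ₖ K)/𝔓 = dim A/𝔭` (GW 5.38: `Q` is minimal over `qA_K`,
and `𝔓` is minimal over `𝔭A_K` by integrality). [cite: GortzWedhorn2020, Prop. 5.38] [cite: Matsumura1987, Thm 5.6] -/
theorem height_map_quotient_eq_of_mem_minimalPrimes [Algebra.IsAlgebraic k K] {Q : Ideal (A ⊗[k] K)}
    (hQ : Q ∈ minimalPrimes (A ⊗[k] K)) (𝔓 : Ideal (A ⊗[k] K)) [𝔓.IsPrime] (hQ𝔓 : Q ≤ 𝔓) :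
    ((𝔓.map (Ideal.Quotient.mk Q)).height : WithBot ℕ∞) = ((𝔓.under A).map (Ideal.Quotient.mk (Q.under A))).height := by
  haveI := hQ.1.1
  haveI : (Q.under A).IsPrime := Ideal.IsPrime.under A Q
  letI : Algebra K (A ⊗[k] K) := Algebra.TensorProduct.rightAlgebra
  haveI : Algebra.FiniteType K (A ⊗[k] K) := finiteType_tensorProduct_right
  have hq𝔭 : Q.under A ≤ 𝔓.under A := Ideal.comap_mono hQ𝔓
  -- primality of the images
  have hker : RingHom.ker (Ideal.Quotient.mk Q) ≤ 𝔓 := by rw [Ideal.mk_ker]; exact hQ𝔓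
  haveI h𝔓' : (𝔓.map (Ideal.Quotient.mk Q)).IsPrime := Ideal.map_isPrime_of_surjective Ideal.Quotient.mk_surjective hker
  have hker' : RingHom.ker (Ideal.Quotient.mk (Q.under A)) ≤ 𝔓.under A := by rw [Ideal.mk_ker]; exact hq𝔭
  haveI h𝔭' : ((𝔓.under A).map (Ideal.Quotient.mk (Q.under A))).IsPrime :=
    Ideal.map_isPrime_of_surjective Ideal.Quotient.mk_surjective hker'
  -- the two dimension formulas
  have hD' := ringKrullDim_quotient_add_height K (𝔓.map (Ideal.Quotient.mk Q))
  have hD := ringKrullDim_quotient_add_height k ((𝔓.under A).map (Ideal.Quotient.mk (Q.under A)))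
  -- GW 5.38 twice
  have e1 : ringKrullDim ((A ⊗[k] K) ⧸ Q) = ringKrullDim (A ⧸ Q.under A) :=
    ringKrullDim_quotient_eq_of_isPushout_of_mem_minimalPrimes (k := k) (L := K) Q
      (mem_minimalPrimes_of_mem_minimalPrimes_of_le hQ (Ideal.map_le_iff_le_comap.mpr le_rfl))
  have e2 : ringKrullDim ((A ⊗[k] K) ⧸ 𝔓) = ringKrullDim (A ⧸ 𝔓.under A) :=
    ringKrullDim_quotient_eq_of_isPushout_of_mem_minimalPrimes (k := k) (L := K) 𝔓
      (mem_minimalPrimes_map_under_of_isIntegral 𝔓)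
  have e3 : ringKrullDim (((A ⊗[k] K) ⧸ Q) ⧸ 𝔓.map (Ideal.Quotient.mk Q)) = ringKrullDim ((A ⊗[k] K) ⧸ 𝔓) :=
    ringKrullDim_eq_of_ringEquiv (DoubleQuot.quotQuotEquivQuotOfLE hQ𝔓)
  have e4 : ringKrullDim ((A ⧸ Q.under A) ⧸ (𝔓.under A).map (Ideal.Quotient.mk (Q.under A))) = ringKrullDim (A ⧸ 𝔓.under A) :=
    ringKrullDim_eq_of_ringEquiv (DoubleQuot.quotQuotEquivQuotOfLE hq𝔭)
  -- everything is a natural number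
  obtain ⟨s, hs⟩ := exists_nat_ringKrullDim_quotient k (Q.under A)
  obtain ⟨t, ht⟩ := exists_nat_ringKrullDim_quotient k (𝔓.under A)
  have hsD' : ringKrullDim ((A ⊗[k] K) ⧸ Q) = s := e1.trans hs
  -- heights are finite
  have hle1 := Ideal.height_le_ringKrullDim_of_ne_top (Ideal.IsPrime.ne_top h𝔓')
  rw [hsD'] at hle1
  have hle1' : (𝔓.map (Ideal.Quotient.mk Q)).height ≤ s := by exact_mod_cast hle1
  obtain ⟨n', hn'⟩ := ENat.ne_top_iff_exists.1 (ne_top_of_le_ne_top (ENat.coe_ne_top s) hle1')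
  have hle2 := Ideal.height_le_ringKrullDim_of_ne_top (Ideal.IsPrime.ne_top h𝔭')
  rw [hs] at hle2
  have hle2' : ((𝔓.under A).map (Ideal.Quotient.mk (Q.under A))).height ≤ s := by exact_mod_cast hle2
  obtain ⟨n, hn⟩ := ENat.ne_top_iff_exists.1 (ne_top_of_le_ne_top (ENat.coe_ne_top s) hle2')
  rw [e3, e2, ht, hsD', ← hn'] at hD'
  rw [e4, ht, hs, ← hn] at hD
  have h1 : t + n' = s := by exact_mod_cast hD'
  have h2 : t + n = s := by exact_mod_cast hD
  rw [← hn', ← hn]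
  have : n' = n := by omega
  rw [this]

/-- **`ψ` IS INVARIANT UNDER GROUND-FIELD EXTENSION: `ψ[(A ⊗ₖ K)_𝔓] = ψ[A_𝔭]`** for `A` of finite type over `k`, `K/k` algebraic, `𝔓` a prime
of `A ⊗ₖ K` over `𝔭`. The minimal primes of `(A ⊗ₖ K)_𝔓` are the `Q (A ⊗ₖ K)_𝔓`, `Q ⊆ 𝔓` minimal in `A ⊗ₖ K`; `q = Q ∩ A ⊆ 𝔭` is minimal
in `A` (going-down, flatness) and conversely every minimal `q ⊆ 𝔭` is such a contraction (going-down from `𝔓`); and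
`dim (A ⊗ₖ K)_𝔓 / Q = ht(𝔓/Q) = ht(𝔭/q) = dim A_𝔭/q`. [cite: CossartJannsenSaito2020, Def. 2.28 (2)] [cite: GortzWedhorn2020, Prop. 5.38] -/
theorem minimalPrimesCodim_localization_tensorProduct_eq [Algebra.IsAlgebraic k K] [IsNoetherianRing A]
    [IsNoetherianRing (A ⊗[k] K)] (𝔓 : Ideal (A ⊗[k] K)) [𝔓.IsPrime] :
    minimalPrimesCodim (Localization.AtPrime 𝔓) = minimalPrimesCodim (Localization.AtPrime (𝔓.under A)) := by
  set B := A ⊗[k] K with hB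
  set 𝔭 := 𝔓.under A with h𝔭
  -- the common value of the coheights
  have key : ∀ {Q : Ideal B}, Q ∈ minimalPrimes B → Q ≤ 𝔓 →
      ringKrullDim (Localization.AtPrime 𝔓 ⧸ Q.map (algebraMap B (Localization.AtPrime 𝔓))) =
        ringKrullDim (Localization.AtPrime 𝔭 ⧸ (Q.under A).map (algebraMap A (Localization.AtPrime 𝔭))) := by
    intro Q hQ hQ𝔓
    rw [ringKrullDim_localization_quotient_map_eq_height Q 𝔓 hQ𝔓,
      ringKrullDim_localization_quotient_map_eq_height (Q.under A) 𝔭 (Ideal.comap_mono hQ𝔓)]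
    exact height_map_quotient_eq_of_mem_minimalPrimes hQ 𝔓 hQ𝔓
  have hdisjB : ∀ {Q : Ideal B}, Q ≤ 𝔓 → Disjoint (𝔓.primeCompl : Set B) Q := fun hle =>
    Set.disjoint_left.mpr fun x hx hxQ => hx (hle hxQ)
  have hdisjA : ∀ {q : Ideal A}, q ≤ 𝔭 → Disjoint (𝔭.primeCompl : Set A) q := fun hle =>
    Set.disjoint_left.mpr fun x hx hxq => hx (hle hxq)
  have hle𝔓 : ∀ (𝔔 : Ideal (Localization.AtPrime 𝔓)) [𝔔.IsPrime], 𝔔.under B ≤ 𝔓 := fun 𝔔 _ =>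
    calc 𝔔.under B ≤ (maximalIdeal (Localization.AtPrime 𝔓)).under B :=
          Ideal.comap_mono (IsLocalRing.le_maximalIdeal (Ideal.IsPrime.ne_top inferInstance))
      _ = 𝔓 := Localization.AtPrime.under_maximalIdeal
  have hle𝔭 : ∀ (𝔮 : Ideal (Localization.AtPrime 𝔭)) [𝔮.IsPrime], 𝔮.under A ≤ 𝔭 := fun 𝔮 _ =>
    calc 𝔮.under A ≤ (maximalIdeal (Localization.AtPrime 𝔭)).under A :=
          Ideal.comap_mono (IsLocalRing.le_maximalIdeal (Ideal.IsPrime.ne_top inferInstance))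
      _ = 𝔭 := Localization.AtPrime.under_maximalIdeal
  apply le_antisymm
  · -- `ψ[B_𝔓] ≤ ψ[A_𝔭]`: realise `ψ[A_𝔭]` at `𝔮`, descend to `q ⊆ 𝔭`, lift to a minimal `Q ⊆ 𝔓` over `q` by going-down
    obtain ⟨𝔮, h𝔮, hdim⟩ := exists_minimalPrimes_ringKrullDim_eq_minimalPrimesCodim (Localization.AtPrime 𝔭)
    haveI := h𝔮.1.1
    have hq : 𝔮.under A ∈ minimalPrimes A := under_mem_minimalPrimes_of_isLocalization 𝔭.primeCompl _ h𝔮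
    haveI := hq.1.1
    haveI : 𝔓.LiesOver 𝔭 := ⟨h𝔭⟩
    obtain ⟨P', hP'le, hP', hP'over⟩ := Ideal.exists_ideal_le_liesOver_of_le (p := 𝔮.under A) (q := 𝔭) 𝔓 (hle𝔭 𝔮)
    obtain ⟨Q, hQ, hQle⟩ := Ideal.exists_minimalPrimes_le (I := (⊥ : Ideal B)) (J := P') bot_le
    haveI := hQ.1.1
    have hQ𝔓 : Q ≤ 𝔓 := hQle.trans hP'le
    have hQunder : Q.under A = 𝔮.under A := by
      have h1 : Q.under A ≤ 𝔮.under A := by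
        calc Q.under A ≤ P'.under A := Ideal.comap_mono hQle
          _ = 𝔮.under A := hP'over.over.symm
      exact le_antisymm h1 (hq.2 ⟨Ideal.IsPrime.under A Q, bot_le⟩ h1)
    have hmin : Q.map (algebraMap B (Localization.AtPrime 𝔓)) ∈ minimalPrimes (Localization.AtPrime 𝔓) :=
      map_mem_minimalPrimes_localization 𝔓.primeCompl _ hQ (hdisjB hQ𝔓)
    have hk := key hQ hQ𝔓
    rw [hQunder, IsLocalization.map_under 𝔭.primeCompl (Localization.AtPrime 𝔭) 𝔮, hdim] at hk
    exact minimalPrimesCodim_le _ hmin hk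
  · -- `ψ[A_𝔭] ≤ ψ[B_𝔓]`: realise `ψ[B_𝔓]` at `𝔔`, contract
    obtain ⟨𝔔, h𝔔, hdim⟩ := exists_minimalPrimes_ringKrullDim_eq_minimalPrimesCodim (Localization.AtPrime 𝔓)
    haveI := h𝔔.1.1
    have hQ : 𝔔.under B ∈ minimalPrimes B := under_mem_minimalPrimes_of_isLocalization 𝔓.primeCompl _ h𝔔
    haveI := hQ.1.1
    have hQ𝔓 : 𝔔.under B ≤ 𝔓 := hle𝔓 𝔔
    have hq : (𝔔.under B).under A ∈ minimalPrimes A := under_mem_minimalPrimes_of_hasGoingDown hQ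
    have hmin : ((𝔔.under B).under A).map (algebraMap A (Localization.AtPrime 𝔭)) ∈ minimalPrimes (Localization.AtPrime 𝔭) :=
      map_mem_minimalPrimes_localization 𝔭.primeCompl _ hq (hdisjA (Ideal.comap_mono hQ𝔓))
    have hk := key hQ hQ𝔓
    rw [IsLocalization.map_under 𝔓.primeCompl (Localization.AtPrime 𝔓) 𝔔, hdim] at hk
    exact minimalPrimesCodim_le _ hmin hk.symm

end BaseChange

end Summit.ResolutionOfSingularities.ResolutionOfSingularities.Theorems.SigmaMaxModificationsCorridor3.IsoTailsHS

end
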